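import Mathlib.RingTheory.Filtration
import Mathlib.LinearAlgebra.FreeModule.IdealQuotient
import Mathlib.NumberTheory.Padics.RingHoms
import Literature.AnabelianGeometry.EtaleTheta.LogDivisorModelTateTowerArithmeticNumberField

/-!
# [EtTh] Prop. 3.2 (iii) for fraction fields of Dedekind domains with a prime of finite residue rings —
# number fields AND the MLF `ℚ_p` (print proves (iii) for finite extensions of `ℚ_p`; the number-field case is ours)

S. Mochizuki, *The étale theta function …*, Publ. RIMS **45** (2009) [MochizukiEtTh2009], §3 Prop. 3.2 (iii) (PRIMS
PDF p.70) [cite: MochizukiEtTh2009, Prop 3.2 p.70].  abc-iut cell, seat abc-iut-w5-d223 gen 6; in-lineage sequel to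
`LogDivisorModelTateTowerArithmeticNumberField.lean` (p473352: §A generic Dedekind lemmas, §B the number-field case
via Dirichlet).  Print proves (iii) ONLY for `L` a finite extension of `ℚ_p` (printed p.297, "the well-known
structure of `O_L^×`"; referee pin F-D15-12 — the number-field case is the lineage's own extension).  THIS FILE gives
the UNIFORM Krull-intersection proof covering print's case `ℚ_p` and re-deriving ours:
* **`DedekindDivisible.units_eq_one_of_finite_quotients`** — `R` Dedekind with fraction field `K` and ONE height-one
  prime `P` all of whose residue rings `R ⧸ Pᵏ` are finite: an infinitely divisible `c ∈ K^×` is `1` (by §A it is a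
  unit `u` of `R` infinitely divisible in `R^×`; in each finite group `(R ⧸ Pᵏ)^×` a `#(R ⧸ Pᵏ)^×`-th power is
  trivial, so `u − 1 ∈ ⋂ₖ Pᵏ = 0` by Krull's intersection theorem `Ideal.iInf_pow_eq_bot_of_isDomain`);
* `NumberFieldDivisible.units_eq_one_of_forall_exists_pow_eq'` — the number-field case re-derived through any prime
  (`Ideal.finiteQuotientOfFreeOfNeBot`), agreeing with §B;
* **`PadicDivisible.units_eq_one_of_forall_exists_pow_eq : ∀ c : ℚ_[p]ˣ, (∀ N ≥ 1, ∃ d, d ^ N = c) → c = 1`** — the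
  MLF `ℚ_p` (`ℤ_[p] ⧸ (p)ᵏ ↪ ZMod (pᵏ)` via `PadicInt.toZModPow`), with `PadicDivisible.primeSpec p` the height-one
  prime `(p) ⊆ ℤ_[p]` and `finite_quotient_primeSpec_pow`. Classical lemmas print assumes; no new Prop-valued fact, no
  `instance`, no notation.  HONEST FRAMING: supporting lemmas for the typed [EtTh] §3 interfaces
  (`TateTowerArith.Datum.eq_one_of_divisible`); nothing of [EtTh] asserted; nothing here bears on [IUTchIII] Cor.
  3.12; no side taken; typed ≠ proved.
-/

noncomputable section

namespace Literature.AnabelianGeometry.EtaleTheta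

open IsDedekindDomain

namespace DedekindDivisible

variable {R : Type*} [CommRing R] [IsDedekindDomain R] {K : Type*} [Field K] [Algebra R K] [IsFractionRing R K]

omit [IsDedekindDomain R] in
/-- A unit of `R` that is a `#(R ⧸ I)^×`-th power is `≡ 1 (mod I)` when `R ⧸ I` is finite. [folklore] -/
private theorem sub_one_mem_of_pow (I : Ideal R) [Finite (R ⧸ I)] (u d : Rˣ)
    (hd : d ^ Nat.card (R ⧸ I)ˣ = u) : (u : R) - 1 ∈ I := by
  rw [← Ideal.Quotient.eq_zero_iff_mem, map_sub, map_one, sub_eq_zero]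
  have h : Units.map (Ideal.Quotient.mk I : R →* R ⧸ I) u = 1 := by
    rw [← hd, map_pow]
    exact pow_card_eq_one'
  have := congrArg (fun x : (R ⧸ I)ˣ => (x : R ⧸ I)) h
  simpa using this

/-- **Prop. 3.2 (iii) by Krull intersection**: if the Dedekind domain `R` has a height-one prime `P` with ALL residue
rings `R ⧸ Pᵏ` finite (number fields; rings of integers of MLFs), then an element of `K^× = Frac(R)^×` admitting an
`N`-th root for every `N ≥ 1` is `1`. [cite: MochizukiEtTh2009, Prop 3.2 p.70] -/
theorem units_eq_one_of_finite_quotients (P : HeightOneSpectrum R) (hfin : ∀ k : ℕ, Finite (R ⧸ P.asIdeal ^ k))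
    (c : Kˣ) (h : ∀ N : ℕ+, ∃ d : Kˣ, d ^ (N : ℕ) = c) : c = 1 := by
  obtain ⟨u, hu, hdiv⟩ := exists_units_eq_of_forall_exists_pow_eq (R := R) c h
  have hmem : ∀ k : ℕ, (u : R) - 1 ∈ P.asIdeal ^ k := by
    intro k
    haveI := hfin k
    haveI : Nonempty (R ⧸ P.asIdeal ^ k)ˣ := ⟨1⟩
    obtain ⟨d, hd⟩ := hdiv ⟨Nat.card (R ⧸ P.asIdeal ^ k)ˣ, Nat.card_pos⟩
    exact sub_one_mem_of_pow (P.asIdeal ^ k) u d (by rw [← hd, PNat.mk_coe])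
  have hkrull : (⨅ k : ℕ, P.asIdeal ^ k) = ⊥ := Ideal.iInf_pow_eq_bot_of_isDomain P.asIdeal P.isPrime.ne_top
  have h0 : (u : R) - 1 ∈ (⨅ k : ℕ, P.asIdeal ^ k) := Ideal.mem_iInf.mpr hmem
  rw [hkrull, Ideal.mem_bot, sub_eq_zero] at h0
  apply Units.ext
  rw [← hu, h0, map_one, Units.val_one]

end DedekindDivisible

/-! ### The number-field case through an arbitrary prime (agrees with §B of the predecessor file) -/

namespace NumberFieldDivisible

open NumberField

/-- Prop. 3.2 (iii) for a number field `K`, re-derived by Krull intersection at ANY height-one prime of `𝓞 K` (all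
residue rings `𝓞 K ⧸ Pᵏ` are finite). [cite: MochizukiEtTh2009, Prop 3.2 p.70] -/
theorem units_eq_one_of_forall_exists_pow_eq' (K : Type*) [Field K] [NumberField K] (P : HeightOneSpectrum (𝓞 K))
    (c : Kˣ) (h : ∀ N : ℕ+, ∃ d : Kˣ, d ^ (N : ℕ) = c) : c = 1 :=
  DedekindDivisible.units_eq_one_of_finite_quotients P
    (fun k => Ideal.finiteQuotientOfFreeOfNeBot (P.asIdeal ^ k) (pow_ne_zero k P.ne_bot)) c h

end NumberFieldDivisible

/-! ### The MLF `ℚ_p` -/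

namespace PadicDivisible

variable (p : ℕ) [Fact p.Prime]

/-- The height-one prime `(p) ⊆ ℤ_[p]` (the maximal ideal). [cite: MochizukiEtTh2009, Def 3.1 p.70] -/
def primeSpec : HeightOneSpectrum ℤ_[p] where
  asIdeal := IsLocalRing.maximalIdeal ℤ_[p]
  isPrime := inferInstance
  ne_bot := by
    rw [PadicInt.maximalIdeal_eq_span_p, Ne, Ideal.span_singleton_eq_bot]
    exact_mod_cast (Fact.out : p.Prime).ne_zero

/-- `ℤ_[p] ⧸ (p)ᵏ` is finite (it embeds in — indeed equals — `ZMod (pᵏ)` via `PadicInt.toZModPow`).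
[cite: MochizukiEtTh2009, Prop 3.2 p.70] -/
theorem finite_quotient_primeSpec_pow (k : ℕ) : Finite (ℤ_[p] ⧸ (primeSpec p).asIdeal ^ k) := by
  have hker : RingHom.ker (PadicInt.toZModPow k : ℤ_[p] →+* ZMod (p ^ k)) =
      (primeSpec p).asIdeal ^ k := by
    rw [PadicInt.ker_toZModPow]
    change Ideal.span {(p : ℤ_[p]) ^ k} = IsLocalRing.maximalIdeal ℤ_[p] ^ k
    rw [PadicInt.maximalIdeal_eq_span_p, Ideal.span_singleton_pow]
  have e : ℤ_[p] ⧸ (primeSpec p).asIdeal ^ k ≃+* ZMod (p ^ k) :=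
    (Ideal.quotEquivOfEq hker.symm).trans
      (RingHom.quotientKerEquivOfSurjective (ZMod.ringHom_surjective (PadicInt.toZModPow k)))
  exact Finite.of_equiv _ e.toEquiv.symm

/-- **Prop. 3.2 (iii) for the MLF `ℚ_p`**: an element of `ℚ_p^×` admitting an `N`-th root for every `N ≥ 1` is `1`.
[cite: MochizukiEtTh2009, Prop 3.2 p.70] -/
theorem units_eq_one_of_forall_exists_pow_eq (c : ℚ_[p]ˣ) (h : ∀ N : ℕ+, ∃ d : ℚ_[p]ˣ, d ^ (N : ℕ) = c) :
    c = 1 :=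
  DedekindDivisible.units_eq_one_of_finite_quotients (primeSpec p) (finite_quotient_primeSpec_pow p) c h

end PadicDivisible

end Literature.AnabelianGeometry.EtaleTheta

end
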